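import Summits.NavierStokesRegularity.NavierStokesRegularity.Theses.QuantisedSymmetry
import Summits.NavierStokesRegularity.NavierStokesRegularity.Theorems.QuantisedSymmetryQuantisedOrderSymmetry
import Summits.NavierStokesRegularity.NavierStokesRegularity.Theorems.QuantisedSymmetryQuantisedOrderAverage
import Summits.NavierStokesRegularity.NavierStokesRegularity.Theorems.QuantisedSymmetryQuantisedOrderZoom
import Literature.Analysis.FluidPDE.LocalTypeIProofs
import Literature.Analysis.FluidPDE.LocalTypeIPersistenceHolds
import HarnessLib

/-!
# Route QuantisedSymmetry, item `QuantisedOrder` (stmt-NavierStokesRegularity-11293):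
# Lemma Q — «viscosity quantises symmetry»

**Theorem (`quantisedSymmetry_quantisedOrder_proof`).** Assume the local theorem of
Seregin–Šverák (Comm. PDE 34 (2009), Thm. 3.1 = Thm. 1.1; the inlined antecedent of the item, which
is verbatim the catalogued barrier `Literature.Barriers.NavierStokesRegularity.AxisymmetricTypeIExclusion`
and is PROVED in the tree as `AxisymmetricTypeIExclusion_holds`): an axisymmetric distributional
solution in the unit cylinder with `u ∈ L³`, `p ∈ L^{3/2}` and the Type I bound `√(-t)|u| ≤ C` a.e.
is essentially bounded near the vertex.  Then for every Type I constant `C` and norm bound `M`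
there is `N` such that for all `n ≥ N` every Albritton–Barker suitable weak solution `(u, p)` in
the unit parabolic ball `Q(0, 1)` with `‖u‖_{L³(Q(0,1))} ≤ M`, `‖p‖_{L^{3/2}(Q(0,1))} ≤ M`,
`C_n`-equivariant slices about the `x₃`-axis (`u(t, R_{2π/n} x) = R_{2π/n} u(t, x)`, `-1 < t < 0`)
and `√(-t)|u| ≤ C` a.e. on `Q(0, 1)` is essentially bounded on some `Q(0, r)`: a discrete
rotational symmetry of large order is as fatal to a Type I singularity as full axisymmetry.

## Proof (compactness + contradiction; `N = N(C, M)` is ineffective)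

If not, there are `n_k ≥ k + 1` and pairs `(v_k, q_k)` in the class with a (backward) singular
origin.  Lin's compactness (`SuitableCompactness_holds`, Albritton–Barker 2019 Lemma 2.2) gives a
subsequence converging in `L³(Q(0, R))`, `R < 1`, to a suitable weak solution `(U, P)`, whose origin
is singular by persistence of singularities (`PersistenceOfSingularities_holds`, A–B Prop. 2.3 =
Rusin–Šverák 2011).  The Type I bound passes to the limit a.e. (file `…Zoom`).  By file `…Symmetry`
(lattice angles `2πm/n_k` are dense; test-function argument) `U` is a.e. equivariant under EVERY
rotation about the axis on `Q(0, ½)`, and by file `…Average` (SO(2)-average of a measurable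
representative) it has a representative `Ū` with pointwise axisymmetric slices; `(Ū, P)` is still
in the class (`IsSuitableWeakSolutionInBall.congr_ae'`) with a singular origin.  Zooming by the
factor `¼` (`IsSuitableWeakSolutionInBall.zoomOut`) puts the pair on `Q(0, 2) ⊇ 𝒞 × ]-1, 0[` with
the same Type I constant; the antecedent then makes the zoomed field essentially bounded near the
origin, contradicting the (zoom-invariant) singularity.

All inputs are tree theorems; the conclusion is a statement about MODEL symmetry classes of
hypothetical Type I singularities, not a regularity claim.

## References

* G. Seregin, V. Šverák, Comm. PDE 34 (2009) = arXiv:0804.1803, Thm. 3.1 (= Thm. 1.1), §3.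
  [SereginSverak2009]
* D. Albritton, T. Barker, arXiv:1811.00502, Lemma 2.2, Prop. 2.3, Rem. 3.2. [AlbrittonBarker2019]
* W. Rusin, V. Šverák, J. Funct. Anal. 260 (2011), Lemmas 2.1–2.2. [RusinSverak2011]
* F. Lin, CPAM 51 (1998), Thm. 2.2. [Lin1998]
-/

set_option linter.dupNamespace false

noncomputable section

open MeasureTheory Set Function Filter Topology Metric
open scoped ENNReal NNReal

namespace Summit.NavierStokesRegularity.NavierStokesRegularity.Theorems

open Literature.Analysis.FluidPDE Literature.Barriers.NavierStokesRegularity QuantisedOrder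

/-- **Lemma Q (`QuantisedSymmetry.QuantisedOrder`, stmt-NavierStokesRegularity-11293): under the
Seregin–Šverák axisymmetric Type I exclusion (inlined antecedent), `C_n`-equivariant Type I suitable
weak solutions in `Q(0, 1)` with `‖u‖₃, ‖p‖_{3/2} ≤ M` and `n ≥ N(C, M)` are bounded near the
origin.** [cite: SereginSverak2009, Thm. 3.1 (= Thm. 1.1)] -/
theorem quantisedSymmetry_quantisedOrder_proof :
    Summit.NavierStokesRegularity.NavierStokesRegularity.Theses.QuantisedSymmetry.QuantisedOrder := by
  intro hA C M
  by_contra hneg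
  push Not at hneg
  -- a singular sequence with `n_k → ∞`
  choose n hn u p hball hu3 hp32 hsym hTI hsing using hneg
  set v : ℕ → ℝ → EuclideanSpace ℝ (Fin 3) → EuclideanSpace ℝ (Fin 3) := fun k => u (k + 1) with hv
  set q : ℕ → ℝ → EuclideanSpace ℝ (Fin 3) → ℝ := fun k => p (k + 1) with hq
  set μ1 := (volume : Measure (ℝ × EuclideanSpace ℝ (Fin 3))).restrict
    (parabolicCylinder 1 (0 : ℝ × EuclideanSpace ℝ (Fin 3))) with hμ1
  have hball' : ∀ k, IsSuitableWeakSolutionInBall 1 0 (v k) (q k) := fun k => hball (k + 1)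
  have hsup : (⨆ k, eLpNorm (uncurry (v k)) 3 μ1 + eLpNorm (uncurry (q k)) (3 / 2) μ1) < ⊤ := by
    refine lt_of_le_of_lt (iSup_le fun k => add_le_add (hu3 (k + 1)) (hp32 (k + 1))) ?_
    exact ENNReal.add_lt_top.2 ⟨ENNReal.ofReal_lt_top, ENNReal.ofReal_lt_top⟩
  have hsing' : ∀ k, IsBackwardSingularPoint (v k) 0 := fun k r hr =>
    top_le_iff.1 (hsing (k + 1) r hr)
  -- Lin's compactness (A–B Lemma 2.2)
  obtain ⟨U, P, σ, hσ, hlim⟩ := SuitableCompactness_holds v q hball' hsup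
  -- persistence of singularities (A–B Prop. 2.3)
  have hsingU : IsBackwardSingularPoint U 0 := by
    refine PersistenceOfSingularities_holds (fun j => v (σ j)) (fun j => q (σ j)) U P
      (fun j => hball' (σ j)) ?_ ?_ ?_
    · refine lt_of_le_of_lt (iSup_le fun j => ?_) hsup
      exact le_iSup (fun k => eLpNorm (uncurry (v k)) 3 μ1 + eLpNorm (uncurry (q k)) (3 / 2) μ1) (σ j)
    · intro R hR
      obtain ⟨h1, -, h3, h4⟩ := hlim R hR
      exact ⟨h1, h3, h4⟩
    · intro R hR
      have e : (fun j => eLpNorm (uncurry (v (σ j))) ⊤ ((volume : Measure (ℝ × EuclideanSpace ℝ (Fin 3))).restrict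
          (parabolicCylinder R (0 : ℝ × EuclideanSpace ℝ (Fin 3))))) = fun _ => ⊤ :=
        funext fun j => hsing' (σ j) R hR.1
      rw [e]
      exact limsup_const ⊤
  -- the limit on `Q(0, ½)`
  have h12 : (1 / 2 : ℝ) ∈ Ioo (0 : ℝ) 1 := ⟨by norm_num, by norm_num⟩
  obtain ⟨hballU, hU3, hconv, -⟩ := hlim (1 / 2) h12
  set Q := parabolicCylinder (1 / 2 : ℝ) (0 : ℝ × EuclideanSpace ℝ (Fin 3)) with hQ
  set μQ := (volume : Measure (ℝ × EuclideanSpace ℝ (Fin 3))).restrict Q with hμQ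
  have hQ1 : Q ⊆ parabolicCylinder 1 (0 : ℝ × EuclideanSpace ℝ (Fin 3)) :=
    SuitableCompactness.parabolicCylinder_zero_mono (by norm_num) (by norm_num)
  have hvm : ∀ j, AEStronglyMeasurable (uncurry (v (σ j))) μQ := fun j =>
    ((hball' (σ j)).1.distributional.1.aestronglyMeasurable).mono_measure
      (Measure.restrict_mono hQ1 le_rfl)
  have hUm : AEStronglyMeasurable (uncurry U) μQ := hU3.aestronglyMeasurable
  -- the Type I bound passes to the limit
  have hTIU : ∀ᵐ z ∂μQ, Real.sqrt (-z.1) * ‖U z.1 z.2‖ ≤ C :=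
    ae_typeI_of_tendsto_eLpNorm hvm hUm hconv fun j =>
      ae_restrict_of_ae_restrict_of_subset hQ1 (hTI (σ j + 1))
  -- a.e. equivariance of the limit under every rotation
  have hn0 : ∀ j, 0 < n (σ j + 1) := fun j => lt_of_lt_of_le (Nat.succ_pos _) (hn (σ j + 1))
  have hnt : Tendsto (fun j => (n (σ j + 1) : ℝ)) atTop atTop := by
    refine tendsto_natCast_atTop_atTop.comp ?_
    exact tendsto_atTop_mono (fun j => (Nat.le_succ (σ j)).trans (hn (σ j + 1))) hσ.tendsto_atTop
  have hsymU : ∀ θ : ℝ, ∀ᵐ z ∂μQ, U z.1 (rotZ θ z.2) = rotZ θ (U z.1 z.2) :=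
    ae_equivariant_of_tendsto (R := 1 / 2) (by norm_num) (w := fun j => v (σ j))
      (n := fun j => n (σ j + 1)) hn0 hnt (fun j => hsym (σ j + 1)) hvm hU3 hconv
  -- the SO(2)-averaged representative
  obtain ⟨Ub, hUb_axi, hUUb⟩ := exists_axisymmetric_repr hUm hsymU
  have hballUb : IsSuitableWeakSolutionInBall (1 / 2) 0 Ub P :=
    hballU.congr_ae' hUUb (Eventually.of_forall fun _ => rfl)
  have hUb3 : MemLp (uncurry Ub) 3 μQ := MemLp.ae_eq hUUb hU3
  have hTIUb : ∀ᵐ z ∂μQ, Real.sqrt (-z.1) * ‖Ub z.1 z.2‖ ≤ C := by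
    filter_upwards [hTIU, hUUb] with z h1 h2
    have h2' : U z.1 z.2 = Ub z.1 z.2 := h2
    rw [← h2']
    exact h1
  have hsingUb : IsBackwardSingularPoint Ub 0 :=
    isBackwardSingularPoint_zero_of_ae_eq (by norm_num) hUUb hsingU
  -- zoom by `¼`: `Q(0, ½) → Q(0, 2) ⊇ 𝒞 × ]-1, 0[`
  set c : ℝ := 1 / 4 with hc
  have hc0 : 0 < c := by norm_num
  have h2c : (1 / 2 : ℝ) / c = 2 := by norm_num [hc]
  set Uc := c • stPull (c ^ 2) c 0 (0 : EuclideanSpace ℝ (Fin 3)) Ub with hUc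
  set Pc := c ^ 2 • stPull (c ^ 2) c 0 (0 : EuclideanSpace ℝ (Fin 3)) P with hPc
  have hballc : IsSuitableWeakSolutionInBall 2 0 Uc Pc := by
    have h := hballUb.zoomOut hc0
    rwa [h2c] at h
  have hsingc : IsBackwardSingularPoint Uc 0 := isBackwardSingularPoint_zero_zoom hc0 hsingUb
  -- the hypotheses of the Seregin–Šverák theorem
  have hdist : IsDistributionalNSSolutionOn ssCylinderOpens 1 0 Uc Pc :=
    IsDistributionalNSSolutionOn.mono_holds hballc.1.distributional
      ssCylinderOpens_le_parabolicCylinderOpens_two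
  have hU3c : ∫⁻ z in ssCylinder, ‖Uc z.1 z.2‖ₑ ^ (3 : ℕ) < ⊤ := by
    have h := lintegral_cube_zoom_lt_top hc0 hUb3 (S := ssCylinder) (by
      rw [h2c]; exact rlAxisymRegular_ssCylinder_subset)
    exact h
  have hPc : ∫⁻ z in ssCylinder, ‖Pc z.1 z.2‖ₑ ^ (3 / 2 : ℝ) < ⊤ :=
    lintegral_threeHalves_lt_top_of_memLp hballc.2.2.2 rlAxisymRegular_ssCylinder_subset
  have haxi : ∀ t ∈ Ioo (-1 : ℝ) 0, IsAxisymmetric (Uc t) := fun t _ => isAxisymmetric_zoom hUb_axi t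
  have hTIc : ∃ C' : ℝ, ∀ᵐ z ∂((volume : Measure (ℝ × EuclideanSpace ℝ (Fin 3))).restrict ssCylinder),
      Real.sqrt (-z.1) * ‖Uc z.1 z.2‖ ≤ C' := by
    refine ⟨C, ?_⟩
    have h := ae_typeI_zoom hc0 (R := 1 / 2) hTIUb
    rw [h2c] at h
    exact ae_restrict_of_ae_restrict_of_subset rlAxisymRegular_ssCylinder_subset h
  -- the barrier: the zoomed field is bounded near the origin — contradiction
  obtain ⟨r, hr, hbdd⟩ := hA Uc Pc hdist hU3c hPc haxi hTIc
  exact hbdd.ne (hsingc r hr)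

end Summit.NavierStokesRegularity.NavierStokesRegularity.Theorems

end
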